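import Mathlib.Combinatorics.SetFamily.HarrisKleitman
import Mathlib.Algebra.Order.BigOperators.Group.Finset
import Mathlib.Algebra.BigOperators.Group.Finset.Piecewise
import Mathlib.Order.Antichain
import Mathlib.Tactic.Linarith

/-!
# The comb hierarchy for Sahi's `E₃` / Kahn's Conjecture 5: **ABSTRACT PAIR SATURATION** —
# a slot-symmetric functional with a signed profile is nonnegative on all triples of up-sets as soon as the profile of every
# MUTUALLY SATURATED PAIR (2-coloured antichain with a large free antichain) lies in the dual cone of the up-sets

Support file (cell `prim-sahi`, seat `prim-sahi-typer` gen 34; `--supports stmt-CriticalPhenomena-4575`).  Pure proofs on an arbitrary finite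
partial order `α`; the only definitions are bookkeeping (`PairSat.InDual`, `transfer`, `coGen`, `minEl`, `ptRank`, `phi`, `Free`, `Better`) and the
predicates `PairSat.IsNF`, `PairSat.PairCond`, `PairSat.SignedProfile`; no `sorry`, standard axioms.  This is the functional-agnostic form of typer
gen 31's `SahiGridPattern.patternPos_of_pairCond` (there for the pattern functional of the grid `[3]^d`); its first consumer is the twisted
three-partition functional `N_τ` of the cube (`…ThreePartitionPairSaturation`, the SIX-LETTER programme for (M⁺-3)).

THE MATHEMATICS.  `S(A,B,C) ∈ ℤ` is a functional on triples of finsets of `α`, symmetric under the two slot transpositions, with a PROFILE `P`: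
`S(A,B,C) = Σ_{y∈C} P(A,B)(y)`, obeying the SIGN LAW for up-sets `A, B`: `P(A,B)(y) ≥ 0` if `y ∈ A ∩ B`, `≤ 0` otherwise (`SignedProfile`).  MOVES:
insert into `A` a maximal non-element `x ∉ B ∩ C` (`S` changes by `P(B,C)(x) ≤ 0`), erase from `A` a minimal element `m ∈ B ∩ C` (`S` drops by
`P(B,C)(m) ≥ 0`); the potential `phi` (a point in none of the sets counts 2, in one or three 1, in two 0) drops at each move, so every triple of
up-sets dominates one in NORMAL FORM (`exists_isNF_le`), whose two slots with the fewest maximal non-elements satisfy `PairCond`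
(`pairCond_of_isNF`): up-sets, `coGen A ⊆ B`, `coGen B ⊆ A` (a 2-COLOURED ANTICHAIN `coGen A ⊔ coGen B`), minimal elements of one lying in the
other FREE (incomparable to that antichain), and a free antichain at least as large as `coGen A` and `coGen B`.  **`PairSat.nonneg_of_pairCond`**:
if `P(A,B)` lies in the dual cone of the up-sets (`InDual`) for every pair with `PairCond`, then `S ≥ 0` on all triples of up-sets.
`inDual_of_transfer`: DOWNWARD TRANSPORT is sound — the trusted kernel of any transport checker.  Nothing conjectural is asserted. [this work]
-/

namespace Summit.CriticalPhenomena.PercolationContinuityZ3.Theorems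

/-! ## 1. Abstract pair saturation -/

namespace PairSat

open Finset
open scoped Classical

variable {α : Type*} [Fintype α] [PartialOrder α]

/-! ### The dual cone of the up-sets and downward transport -/

/-- `InDual c`: the function `c` lies in the dual cone of the up-sets (`Σ_{y∈U} c y ≥ 0` for every up-set `U`). [this work] -/
def InDual (c : α → ℤ) : Prop := ∀ U : Finset α, IsUpperSet (U : Set α) → 0 ≤ ∑ y ∈ U, c y

omit [Fintype α] in
/-- A pointwise nonnegative function lies in the dual cone. [this work] -/
theorem inDual_of_nonneg {c : α → ℤ} (h : ∀ y, 0 ≤ c y) : InDual c := fun _ _ => Finset.sum_nonneg fun y _ => h y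

/-- One downward transfer: move `a` units from `w` to `y`. [this work] -/
noncomputable def transfer (c : α → ℤ) (w y : α) (a : ℤ) : α → ℤ :=
  fun x => c x - (if x = w then a else 0) + (if x = y then a else 0)

omit [Fintype α] in
/-- **Soundness of downward transport**: if `y ≤ w`, `a ≥ 0` and the transferred function lies in the dual cone, so does `c`. [this work] -/
theorem inDual_of_transfer {c : α → ℤ} {w y : α} {a : ℤ} (hyw : y ≤ w) (ha : 0 ≤ a) (h : InDual (transfer c w y a)) :
    InDual c := by
  intro U hU
  have hle : ∑ x ∈ U, transfer c w y a x ≤ ∑ x ∈ U, c x := by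
    unfold transfer
    rw [Finset.sum_add_distrib, Finset.sum_sub_distrib, Finset.sum_ite_eq' U w, Finset.sum_ite_eq' U y]
    by_cases hy : y ∈ U
    · have hw : w ∈ U := hU hyw hy
      rw [if_pos hy, if_pos hw]; linarith
    · rw [if_neg hy]; split_ifs <;> linarith
  exact le_trans (h U hU) hle

/-- `coGen A`: the maximal elements of the complement of `A` (for an up-set `A`: its co-generators). [this work] -/
noncomputable def coGen (A : Finset α) : Finset α := univ.filter fun x => x ∉ A ∧ ∀ y, x < y → y ∈ A

/-- `minEl A`: the minimal elements of `A`. [this work] -/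
noncomputable def minEl (A : Finset α) : Finset α := A.filter fun x => ∀ y, y < x → y ∉ A

/-- Membership in `coGen`. [this work] -/
theorem mem_coGen {A : Finset α} {x : α} : x ∈ coGen A ↔ x ∉ A ∧ ∀ y, x < y → y ∈ A := by
  unfold coGen; simp only [mem_filter, mem_univ, true_and]

/-- Membership in `minEl`. [this work] -/
theorem mem_minEl {A : Finset α} {x : α} : x ∈ minEl A ↔ x ∈ A ∧ ∀ y, y < x → y ∉ A := by
  unfold minEl; rw [mem_filter]

/-- `coGen A` is an antichain. [this work] -/
theorem isAntichain_coGen (A : Finset α) : IsAntichain (· ≤ ·) (coGen A : Set α) := by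
  intro x hx y hy hne hle
  rw [Finset.mem_coe, mem_coGen] at hx hy
  exact hy.1 (hx.2 y (lt_of_le_of_ne hle hne))

/-- Adding a maximal non-element to an up-set gives an up-set. [this work] -/
theorem isUpperSet_insert_of_mem_coGen {A : Finset α} (hA : IsUpperSet (A : Set α)) {x : α} (hx : x ∈ coGen A) :
    IsUpperSet ((insert x A : Finset α) : Set α) := by
  intro u v huv hu
  rw [Finset.mem_coe, mem_insert] at hu ⊢
  rcases hu with rfl | hu
  · rcases eq_or_lt_of_le huv with rfl | hlt
    · exact Or.inl rfl
    · exact Or.inr ((mem_coGen.1 hx).2 v hlt)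
  · exact Or.inr (hA huv hu)

/-- Removing a minimal element from an up-set gives an up-set. [this work] -/
theorem isUpperSet_erase_of_mem_minEl {A : Finset α} (hA : IsUpperSet (A : Set α)) {m : α} (hm : m ∈ minEl A) :
    IsUpperSet ((A.erase m : Finset α) : Set α) := by
  intro u v huv hu
  rw [Finset.mem_coe, mem_erase] at hu ⊢
  refine ⟨fun hvm => ?_, hA huv hu.2⟩
  subst hvm
  exact (mem_minEl.1 hm).2 u (lt_of_le_of_ne huv hu.1) hu.2

/-- Point rank: 2 if the point is in none of the three sets, 1 if it is in exactly one or in all three, 0 if in exactly two. [this work] -/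
noncomputable def ptRank (A B C : Finset α) (x : α) : ℕ :=
  if (if x ∈ A then 1 else 0) + (if x ∈ B then 1 else 0) + (if x ∈ C then 1 else 0) = 0 then 2
  else if (if x ∈ A then 1 else 0) + (if x ∈ B then 1 else 0) + (if x ∈ C then 1 else 0) = 2 then 0 else 1

/-- The potential `phi = Σ_x ptRank`. [this work] -/
noncomputable def phi (A B C : Finset α) : ℕ := ∑ x, ptRank A B C x

omit [Fintype α] [PartialOrder α] in
/-- `ptRank` is symmetric in the first two sets. [this work] -/
theorem ptRank_swap12 (A B C : Finset α) (x : α) : ptRank A B C x = ptRank B A C x := by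
  unfold ptRank; rw [add_comm (if x ∈ A then 1 else 0) (if x ∈ B then 1 else 0)]

omit [Fintype α] [PartialOrder α] in
/-- `ptRank` is symmetric in the last two sets. [this work] -/
theorem ptRank_swap23 (A B C : Finset α) (x : α) : ptRank A B C x = ptRank A C B x := by
  unfold ptRank; rw [add_assoc, add_comm (if x ∈ B then 1 else 0) (if x ∈ C then 1 else 0), ← add_assoc]

omit [PartialOrder α] in
/-- `phi` is symmetric in the first two sets. [this work] -/
theorem phi_swap12 (A B C : Finset α) : phi A B C = phi B A C :=
  Finset.sum_congr rfl fun x _ => ptRank_swap12 A B C x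

omit [PartialOrder α] in
/-- `phi` is symmetric in the last two sets. [this work] -/
theorem phi_swap23 (A B C : Finset α) : phi A B C = phi A C B :=
  Finset.sum_congr rfl fun x _ => ptRank_swap23 A B C x

omit [PartialOrder α] in
/-- The potential drops when a point outside `A` and outside `B ∩ C` is added to `A`. [this work] -/
theorem phi_insert_lt {A B C : Finset α} {x : α} (hx : x ∉ A) (hbc : ¬ (x ∈ B ∧ x ∈ C)) :
    phi (insert x A) B C < phi A B C := by
  unfold phi
  rw [← Finset.add_sum_erase univ _ (mem_univ x), ← Finset.add_sum_erase univ (ptRank A B C) (mem_univ x)]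
  have hrest : ∑ z ∈ univ.erase x, ptRank (insert x A) B C z = ∑ z ∈ univ.erase x, ptRank A B C z := by
    refine Finset.sum_congr rfl fun z hz => ?_
    have hzx : z ≠ x := (mem_erase.1 hz).1
    unfold ptRank; simp only [mem_insert, hzx, false_or]
  rw [hrest]
  have hlt : ptRank (insert x A) B C x < ptRank A B C x := by
    unfold ptRank
    simp only [mem_insert, true_or, if_true, hx, if_false]
    by_cases hb : x ∈ B <;> by_cases hc : x ∈ C <;> simp [hb, hc] at hbc ⊢
  omega

omit [PartialOrder α] in
/-- The potential drops when a point of `A ∩ B ∩ C` is removed from `A`. [this work] -/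
theorem phi_erase_lt {A B C : Finset α} {m : α} (hm : m ∈ A) (hb : m ∈ B) (hc : m ∈ C) :
    phi (A.erase m) B C < phi A B C := by
  unfold phi
  rw [← Finset.add_sum_erase univ _ (mem_univ m), ← Finset.add_sum_erase univ (ptRank A B C) (mem_univ m)]
  have hrest : ∑ z ∈ univ.erase m, ptRank (A.erase m) B C z = ∑ z ∈ univ.erase m, ptRank A B C z := by
    refine Finset.sum_congr rfl fun z hz => ?_
    have hzm : z ≠ m := (mem_erase.1 hz).1
    unfold ptRank; simp only [mem_erase, hzm, ne_eq, not_false_eq_true, true_and]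
  rw [hrest]
  have hlt : ptRank (A.erase m) B C m < ptRank A B C m := by
    unfold ptRank
    simp [hm, hb, hc]
  omega

/-- **Normal form** of a triple of up-sets: every maximal non-element of each set lies in the other two sets, and no minimal element
of a set lies in both other sets (neither move applies). [this work] -/
structure IsNF (A B C : Finset α) : Prop where
  upA : IsUpperSet (A : Set α)
  upB : IsUpperSet (B : Set α)
  upC : IsUpperSet (C : Set α)
  s1A : ∀ x ∈ coGen A, x ∈ B ∧ x ∈ C
  s1B : ∀ x ∈ coGen B, x ∈ A ∧ x ∈ C
  s1C : ∀ x ∈ coGen C, x ∈ A ∧ x ∈ B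
  s2A : ∀ m ∈ minEl A, ¬ (m ∈ B ∧ m ∈ C)
  s2B : ∀ m ∈ minEl B, ¬ (m ∈ A ∧ m ∈ C)
  s2C : ∀ m ∈ minEl C, ¬ (m ∈ A ∧ m ∈ B)

/-- Normal form is symmetric in the first two slots. [this work] -/
theorem IsNF.swap12 {A B C : Finset α} (h : IsNF A B C) : IsNF B A C where
  upA := h.upB
  upB := h.upA
  upC := h.upC
  s1A := fun x hx => ⟨(h.s1B x hx).1, (h.s1B x hx).2⟩
  s1B := fun x hx => ⟨(h.s1A x hx).1, (h.s1A x hx).2⟩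
  s1C := fun x hx => ⟨(h.s1C x hx).2, (h.s1C x hx).1⟩
  s2A := fun m hm hh => h.s2B m hm ⟨hh.1, hh.2⟩
  s2B := fun m hm hh => h.s2A m hm ⟨hh.1, hh.2⟩
  s2C := fun m hm hh => h.s2C m hm ⟨hh.2, hh.1⟩

/-- Normal form is symmetric in the last two slots. [this work] -/
theorem IsNF.swap23 {A B C : Finset α} (h : IsNF A B C) : IsNF A C B where
  upA := h.upA
  upB := h.upC
  upC := h.upB
  s1A := fun x hx => ⟨(h.s1A x hx).2, (h.s1A x hx).1⟩
  s1B := fun x hx => ⟨(h.s1C x hx).1, (h.s1C x hx).2⟩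
  s1C := fun x hx => ⟨(h.s1B x hx).1, (h.s1B x hx).2⟩
  s2A := fun m hm hh => h.s2A m hm ⟨hh.2, hh.1⟩
  s2B := fun m hm hh => h.s2C m hm ⟨hh.1, hh.2⟩
  s2C := fun m hm hh => h.s2B m hm ⟨hh.1, hh.2⟩

/-- `Free N m`: the point `m` is incomparable to every element of `N`. [this work] -/
def Free (N : Finset α) (m : α) : Prop := ∀ z ∈ N, ¬ m ≤ z ∧ ¬ z ≤ m

/-- **The pair conditions** satisfied by the two smaller slots of a triple in normal form: both up-sets, mutually saturated (the maximal
non-elements of each lie in the other), every minimal element of one lying in the other is free with respect to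
`N = coGen A ∪ coGen B`, and there is a free antichain at least as large as `coGen A` and as `coGen B`. [this work] -/
structure PairCond (A B : Finset α) : Prop where
  upA : IsUpperSet (A : Set α)
  upB : IsUpperSet (B : Set α)
  genA : coGen A ⊆ B
  genB : coGen B ⊆ A
  minA : ∀ m ∈ minEl A, m ∈ B → Free (coGen A ∪ coGen B) m
  minB : ∀ m ∈ minEl B, m ∈ A → Free (coGen A ∪ coGen B) m
  big : ∃ Q : Finset α, (∀ q ∈ Q, Free (coGen A ∪ coGen B) q) ∧ IsAntichain (· ≤ ·) (Q : Set α) ∧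
    (coGen A).card ≤ Q.card ∧ (coGen B).card ≤ Q.card

/-- **From normal form to the pair conditions** (third slot with the most maximal non-elements). [this work] -/
theorem pairCond_of_isNF {A B C : Finset α} (h : IsNF A B C) (hAC : (coGen A).card ≤ (coGen C).card)
    (hBC : (coGen B).card ≤ (coGen C).card) : PairCond A B where
  upA := h.upA
  upB := h.upB
  genA := fun x hx => (h.s1A x hx).1
  genB := fun x hx => (h.s1B x hx).1
  minA := by
    intro m hm hmB z hz
    have hmA : m ∈ A := (mem_minEl.1 hm).1
    have hmC : m ∉ C := fun hmC => h.s2A m hm ⟨hmB, hmC⟩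
    rcases mem_union.1 hz with hz | hz
    · exact ⟨fun hle => (mem_coGen.1 hz).1 (h.upA hle hmA), fun hle => hmC (h.upC hle (h.s1A z hz).2)⟩
    · exact ⟨fun hle => (mem_coGen.1 hz).1 (h.upB hle hmB), fun hle => hmC (h.upC hle (h.s1B z hz).2)⟩
  minB := by
    intro m hm hmA z hz
    have hmB : m ∈ B := (mem_minEl.1 hm).1
    have hmC : m ∉ C := fun hmC => h.s2B m hm ⟨hmA, hmC⟩
    rcases mem_union.1 hz with hz | hz
    · exact ⟨fun hle => (mem_coGen.1 hz).1 (h.upA hle hmA), fun hle => hmC (h.upC hle (h.s1A z hz).2)⟩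
    · exact ⟨fun hle => (mem_coGen.1 hz).1 (h.upB hle hmB), fun hle => hmC (h.upC hle (h.s1B z hz).2)⟩
  big := by
    refine ⟨coGen C, fun q hq z hz => ?_, isAntichain_coGen C, hAC, hBC⟩
    have hqC : q ∉ C := (mem_coGen.1 hq).1
    have hqA : q ∈ A := (h.s1C q hq).1
    have hqB : q ∈ B := (h.s1C q hq).2
    rcases mem_union.1 hz with hz | hz
    · exact ⟨fun hle => (mem_coGen.1 hz).1 (h.upA hle hqA), fun hle => hqC (h.upC hle (h.s1A z hz).2)⟩
    · exact ⟨fun hle => (mem_coGen.1 hz).1 (h.upB hle hqB), fun hle => hqC (h.upC hle (h.s1B z hz).2)⟩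

/-! ### A slot-symmetric functional with a signed profile -/

section Functional

variable (S : Finset α → Finset α → Finset α → ℤ) (P : Finset α → Finset α → α → ℤ)

/-- **A signed profile** for a slot-symmetric functional `S` on triples of finsets: `S(A,B,C) = Σ_{y∈C} P(A,B)(y)`, `S` symmetric under
the two slot transpositions, and the sign law `P(A,B)(y) ≥ 0` for `y ∈ A ∩ B`, `≤ 0` otherwise (for up-sets `A, B`). [this work] -/
structure SignedProfile : Prop where
  sum_eq : ∀ A B C : Finset α, S A B C = ∑ y ∈ C, P A B y
  swap12 : ∀ A B C : Finset α, S A B C = S B A C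
  swap23 : ∀ A B C : Finset α, S A B C = S A C B
  pos : ∀ A B : Finset α, IsUpperSet (A : Set α) → IsUpperSet (B : Set α) → ∀ y, y ∈ A → y ∈ B → 0 ≤ P A B y
  neg : ∀ A B : Finset α, IsUpperSet (A : Set α) → IsUpperSet (B : Set α) → ∀ y, ¬ (y ∈ A ∧ y ∈ B) → P A B y ≤ 0

variable {S P}

omit [Fintype α] in
/-- The functional as a sum over its FIRST slot: `S(A,B,C) = Σ_{y∈A} P(B,C)(y)`. [this work] -/
theorem SignedProfile.sum_eq_first (hS : SignedProfile S P) (A B C : Finset α) : S A B C = ∑ y ∈ A, P B C y := by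
  rw [hS.swap12, hS.swap23, hS.sum_eq]

omit [Fintype α] in
/-- **First-slot insertion**: `S(insert x A, B, C) = S(A,B,C) + P(B,C)(x)` for `x ∉ A`. [this work] -/
theorem SignedProfile.insert₁ (hS : SignedProfile S P) {A : Finset α} {x : α} (hx : x ∉ A) (B C : Finset α) :
    S (insert x A) B C = S A B C + P B C x := by
  rw [hS.sum_eq_first, hS.sum_eq_first, Finset.sum_insert hx, add_comm]

omit [Fintype α] in
/-- First-slot removal: `S(A,B,C) = S(A.erase m, B, C) + P(B,C)(m)` for `m ∈ A`. [this work] -/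
theorem SignedProfile.erase₁ (hS : SignedProfile S P) {A : Finset α} {m : α} (hm : m ∈ A) (B C : Finset α) :
    S A B C = S (A.erase m) B C + P B C m := by
  rw [← hS.insert₁ (Finset.notMem_erase m A) B C, Finset.insert_erase hm]

omit [Fintype α] in
/-- If `P(A,B)` lies in the dual cone then `S(A,B,C) ≥ 0` for every up-set `C`. [this work] -/
theorem SignedProfile.nonneg_of_inDual (hS : SignedProfile S P) {A B C : Finset α} (h : InDual (P A B))
    (hC : IsUpperSet (C : Set α)) : 0 ≤ S A B C := by
  rw [hS.sum_eq]; exact h C hC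

/-- A triple of up-sets with smaller `S` and smaller potential. [this work] -/
def Better (S : Finset α → Finset α → Finset α → ℤ) (A B C : Finset α) : Prop :=
  ∃ A' B' C' : Finset α, IsUpperSet (A' : Set α) ∧ IsUpperSet (B' : Set α) ∧ IsUpperSet (C' : Set α) ∧
    S A' B' C' ≤ S A B C ∧ phi A' B' C' < phi A B C

/-- `Better` transported along the swap of the first two slots. [this work] -/
theorem Better.swap12 (hS : SignedProfile S P) {A B C : Finset α} (h : Better S B A C) : Better S A B C := by
  obtain ⟨A', B', C', hA', hB', hC', hle, hφ⟩ := h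
  refine ⟨B', A', C', hB', hA', hC', ?_, ?_⟩
  · rw [hS.swap12 B' A' C', hS.swap12 A B C]; exact hle
  · rw [phi_swap12 B' A' C', phi_swap12 A B C]; exact hφ

/-- `Better` transported along the swap of the last two slots. [this work] -/
theorem Better.swap23 (hS : SignedProfile S P) {A B C : Finset α} (h : Better S A C B) : Better S A B C := by
  obtain ⟨A', B', C', hA', hB', hC', hle, hφ⟩ := h
  refine ⟨A', C', B', hA', hC', hB', ?_, ?_⟩
  · rw [hS.swap23 A' C' B', hS.swap23 A B C]; exact hle
  · rw [phi_swap23 A' C' B', phi_swap23 A B C]; exact hφ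

/-- Move S1 in the first slot. [this work] -/
theorem better_of_coGen₁ (hS : SignedProfile S P) {A B C : Finset α} (hA : IsUpperSet (A : Set α))
    (hB : IsUpperSet (B : Set α)) (hC : IsUpperSet (C : Set α)) {x : α} (hx : x ∈ coGen A) (hbc : ¬ (x ∈ B ∧ x ∈ C)) :
    Better S A B C := by
  have hxA : x ∉ A := (mem_coGen.1 hx).1
  refine ⟨insert x A, B, C, isUpperSet_insert_of_mem_coGen hA hx, hB, hC, ?_, phi_insert_lt hxA hbc⟩
  rw [hS.insert₁ hxA]
  have := hS.neg B C hB hC x hbc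
  linarith

/-- Move S2 in the first slot. [this work] -/
theorem better_of_minEl₁ (hS : SignedProfile S P) {A B C : Finset α} (hA : IsUpperSet (A : Set α))
    (hB : IsUpperSet (B : Set α)) (hC : IsUpperSet (C : Set α)) {m : α} (hm : m ∈ minEl A) (hbc : m ∈ B ∧ m ∈ C) :
    Better S A B C := by
  have hmA : m ∈ A := (mem_minEl.1 hm).1
  refine ⟨A.erase m, B, C, isUpperSet_erase_of_mem_minEl hA hm, hB, hC, ?_, phi_erase_lt hmA hbc.1 hbc.2⟩
  rw [hS.erase₁ hmA B C]
  have := hS.pos B C hB hC m hbc.1 hbc.2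
  linarith

/-- **Every triple of up-sets dominates a triple in normal form.** [this work] -/
theorem exists_isNF_le (hS : SignedProfile S P) : ∀ (n : ℕ) (A B C : Finset α), IsUpperSet (A : Set α) →
    IsUpperSet (B : Set α) → IsUpperSet (C : Set α) → phi A B C ≤ n →
    ∃ A' B' C' : Finset α, IsNF A' B' C' ∧ S A' B' C' ≤ S A B C := by
  intro n
  induction n with
  | zero =>
    intro A B C hA hB hC hφ
    exact step A B C hA hB hC fun hb => by obtain ⟨_, _, _, _, _, _, _, hlt⟩ := hb; omega
  | succ n ih =>
    intro A B C hA hB hC hφ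
    refine step A B C hA hB hC fun hb => ?_
    obtain ⟨A₁, B₁, C₁, hA₁, hB₁, hC₁, hle, hlt⟩ := hb
    obtain ⟨A', B', C', hnf, hle'⟩ := ih A₁ B₁ C₁ hA₁ hB₁ hC₁ (by omega)
    exact ⟨A', B', C', hnf, le_trans hle' hle⟩
where
  /-- one step: either the triple is in normal form or a move applies -/
  step (A B C : Finset α) (hA : IsUpperSet (A : Set α)) (hB : IsUpperSet (B : Set α)) (hC : IsUpperSet (C : Set α))
      (k : Better S A B C → ∃ A' B' C' : Finset α, IsNF A' B' C' ∧ S A' B' C' ≤ S A B C) :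
      ∃ A' B' C' : Finset α, IsNF A' B' C' ∧ S A' B' C' ≤ S A B C := by
    by_cases h1 : ∀ x ∈ coGen A, x ∈ B ∧ x ∈ C
    · by_cases h2 : ∀ x ∈ coGen B, x ∈ A ∧ x ∈ C
      · by_cases h3 : ∀ x ∈ coGen C, x ∈ A ∧ x ∈ B
        · by_cases h4 : ∀ m ∈ minEl A, ¬ (m ∈ B ∧ m ∈ C)
          · by_cases h5 : ∀ m ∈ minEl B, ¬ (m ∈ A ∧ m ∈ C)
            · by_cases h6 : ∀ m ∈ minEl C, ¬ (m ∈ A ∧ m ∈ B)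
              · exact ⟨A, B, C, ⟨hA, hB, hC, h1, h2, h3, h4, h5, h6⟩, le_refl _⟩
              · push Not at h6; obtain ⟨m, hm, hh⟩ := h6
                exact k (Better.swap23 hS (Better.swap12 hS (better_of_minEl₁ hS hC hA hB hm ⟨hh.1, hh.2⟩)))
            · push Not at h5; obtain ⟨m, hm, hh⟩ := h5
              exact k (Better.swap12 hS (better_of_minEl₁ hS hB hA hC hm ⟨hh.1, hh.2⟩))
          · push Not at h4; obtain ⟨m, hm, hh⟩ := h4
            exact k (better_of_minEl₁ hS hA hB hC hm ⟨hh.1, hh.2⟩)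
        · push Not at h3; obtain ⟨x, hx, hh⟩ := h3
          exact k (Better.swap23 hS (Better.swap12 hS (better_of_coGen₁ hS hC hA hB hx fun h => hh h.1 h.2)))
      · push Not at h2; obtain ⟨x, hx, hh⟩ := h2
        exact k (Better.swap12 hS (better_of_coGen₁ hS hB hA hC hx fun h => hh h.1 h.2))
    · push Not at h1; obtain ⟨x, hx, hh⟩ := h1
      exact k (better_of_coGen₁ hS hA hB hC hx fun h => hh h.1 h.2)

/-- **ABSTRACT PAIR SATURATION**: for a slot-symmetric functional with a signed profile, if the profile of every pair of up-sets
satisfying `PairCond` lies in the dual cone of the up-sets, then the functional is nonnegative on every triple of up-sets. [this work] -/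
theorem nonneg_of_pairCond (hS : SignedProfile S P) (H : ∀ A B : Finset α, PairCond A B → InDual (P A B))
    (A B C : Finset α) (hA : IsUpperSet (A : Set α)) (hB : IsUpperSet (B : Set α)) (hC : IsUpperSet (C : Set α)) :
    0 ≤ S A B C := by
  obtain ⟨A', B', C', hnf, hle⟩ := exists_isNF_le hS (phi A B C) A B C hA hB hC (le_refl _)
  refine le_trans ?_ hle
  -- put the slot with the most maximal non-elements last
  by_cases hc : (coGen A').card ≤ (coGen C').card ∧ (coGen B').card ≤ (coGen C').card
  · exact hS.nonneg_of_inDual (H A' B' (pairCond_of_isNF hnf hc.1 hc.2)) hnf.upC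
  · by_cases ha : (coGen B').card ≤ (coGen A').card ∧ (coGen C').card ≤ (coGen A').card
    · -- slot A' largest: use the triple (B', C', A')
      rw [hS.swap12, hS.swap23]
      exact hS.nonneg_of_inDual (H B' C' (pairCond_of_isNF hnf.swap12.swap23 ha.1 ha.2)) hnf.upA
    · -- slot B' largest: use the triple (A', C', B')
      have hb : (coGen A').card ≤ (coGen B').card ∧ (coGen C').card ≤ (coGen B').card := by omega
      rw [hS.swap23]
      exact hS.nonneg_of_inDual (H A' C' (pairCond_of_isNF hnf.swap23 hb.1 hb.2)) hnf.upB

end Functional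

end PairSat

end Summit.CriticalPhenomena.PercolationContinuityZ3.Theorems
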